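import Literature.Topology.FourManifolds.ClosedModelCollapseTransfer
import HarnessLib

/-!
# Collapsing an ambient space onto the closed model of an openly embedded interior

M. Kervaire, J. Milnor, *Groups of homotopy spheres I*, Ann. of Math. 77 (1963), §7 with the
footnote pp. 528–529 (signatures and intersection numbers of a bounded `W` are read on the closed
homology manifold `Ŵ = W ∪ cone(bW)`), and J. Milnor, *Topology from the Differentiable
Viewpoint* (1965), §7 (the Pontryagin–Thom collapse). `ClosedModelCollapseTransfer.lean`
constructs, for an open embedding of INTERIORS `e : int W_P → int W_U` of two null-cobordisms,
the collapse `Ŵ_U → Ŵ_P` and proves that it carries `[Ŵ_U]` to `[Ŵ_P]`. This file is the variant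
with an arbitrary Hausdorff AMBIENT space `X` in place of `Ŵ_U` — the situation of a compact
codimension-`0` piece `W_P` of a closed manifold `X` (e.g. the tube `N_c = {⟪p, q⟫ ≥ c}` of the
diagonal inside `Sᵏ × Sᵏ`, `SphereProductTube.lean`, on which the diagonal entry `[Σ : Σ]` of
Kosinski's `Γ₈` is computed):

* `Literature.Topology.FourManifolds.NullCobordism.exists_ambientCollapse` — for a
  null-cobordism `c_P` (`W_P` compact with closed nonempty boundary) and an open embedding
  `e : int W_P → X` into a Hausdorff space there is a continuous `π : X → Ŵ_P` with
  `π (e y) = y`, `π = ∞` off the image, a map of pairs `(X, X ∖ e y) → (Ŵ_P, Ŵ_P ∖ y)`, which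
  carries a class `α ∈ Hₘ₊₂(X; ℤ)` to the closed-model class `ẑ_P = j⁻¹ q_* w_P` of a relative
  class `w_P` as soon as the local classes of `α` at `e y` and of `ẑ_P` at `y` come from one
  class on `int W_P` for every `y` (compare local classes at every finite point and conclude by
  `eq_zero_of_forall_toLocal_eq_zero_of_ne_infty`). In particular `π_* [X] = [Ŵ_P]` when
  `W_P` is oriented by the restriction of an orientation of `X`.

Stated existentially (no new definition); everything is proved, no named facts.

## References

* M. A. Kervaire, J. W. Milnor, *Groups of homotopy spheres: I*, Ann. of Math. (2) 77 (1963),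
  §7 with footnote pp. 528–529. [KervaireMilnorAnnals1963]
* J. Milnor, *Topology from the Differentiable Viewpoint*, 1965, §7. [MilnorTDV1965]
-/

noncomputable section

open scoped Manifold ContDiff Topology
open Set Function CategoryTheory CategoryTheory.Limits Topology TopologicalSpace
open Literature.AlgebraicTopology.SingularHomology

namespace Literature.Topology.FourManifolds

namespace NullCobordism

variable {m : ℕ}
variable {MP : Type} [TopologicalSpace MP] [ChartedSpace (EuclideanSpace ℝ (Fin (m + 1))) MP]
  [IsManifold (𝓡 (m + 1)) ∞ MP] [CompactSpace MP] [Nonempty MP]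

/-- **The collapse of an ambient space onto the closed model of an openly embedded interior, and
the transfer of classes** (Kervaire–Milnor 1963, §7 footnote pp. 528–529; Milnor 1965, §7). Let
`c_P` be a null-cobordism of a closed nonempty `(m+1)`-manifold (`W_P = c_P.W` compact), `X` a
Hausdorff space and `e : int W_P → X` an open embedding. Then there is a continuous map
`π : X → Ŵ_P = W_P ∪ cone(∂W_P)` with: `π (e y) = y` (the finite point `y`); `π x = ∞` for `x`
outside the image; `π` maps `X ∖ e y` into `Ŵ_P ∖ y`; and for `α ∈ Hₘ₊₂(X; ℤ)` and a relative
class `w_P ∈ Hₘ₊₂(W_P, ∂W_P; ℤ)` whose closed-model class `ẑ_P` has, at every `y`, local class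
coming from the same class on `int W_P` as the local class of `α` at `e y`, `π_* α = ẑ_P`.
[cite: KervaireMilnorAnnals1963, §7 footnote pp. 528–529] [cite: MilnorTDV1965, §7] -/
theorem exists_ambientCollapse (cP : NullCobordism (m + 1) MP) {X : Type} [TopologicalSpace X]
    [T2Space X] (e : C(ManifoldInterior (m + 1) cP.W, X)) (he : IsOpenEmbedding e) :
    ∃ π : C(X, ClosedModel (m + 1) cP.W),
      (∀ y, π (e y) = ClosedModel.ofInterior y) ∧
      (∀ x, x ∉ range e → π x = ClosedModel.infty) ∧
      (∀ y, MapsTo π ({e y}ᶜ : Set X) ({ClosedModel.ofInterior y}ᶜ : Set _)) ∧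
      ∀ (α : singularHomology ℤ ℤ X (m + 1 + 1))
        (wP : relativeSingularHomology ℤ ℤ cP.W ((𝓡∂ (m + 1 + 1)).boundary cP.W) (m + 1 + 1)),
        (∀ y : ManifoldInterior (m + 1) cP.W,
          ∃ ζ : localHomology ℤ ℤ (ManifoldInterior (m + 1) cP.W) y (m + 1 + 1),
            singularHomology.toLocal ℤ ℤ (e y) (m + 1 + 1) α =
              relativeSingularHomology.map ℤ ℤ e
                (LocalFamily.mapsTo_compl_pt he.injective y) (m + 1 + 1) ζ ∧
            singularHomology.toLocal ℤ ℤ (ClosedModel.ofInterior y) (m + 1 + 1)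
                (cP.closedModelClass ℤ ℤ (Nat.le_add_left 1 m) wP) =
              relativeSingularHomology.map ℤ ℤ (ofInteriorCM cP)
                (LocalFamily.mapsTo_compl_pt (isOpenEmbedding_ofInteriorCM cP).injective y)
                (m + 1 + 1) ζ) →
        singularHomology.map ℤ ℤ π (m + 1 + 1) α =
          cP.closedModelClass ℤ ℤ (Nat.le_add_left 1 m) wP := by
  -- the collapse attached to the open set `range e ≅ int W_P`
  set φ : ↥(range e) ≃ₜ ManifoldInterior (m + 1) cP.W := he.isEmbedding.toHomeomorph.symm with hφ
  have hφy : ∀ y, φ ⟨e y, ⟨y, rfl⟩⟩ = y := fun y =>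
    (Homeomorph.symm_apply_eq _).2 (Subtype.ext rfl)
  set π : C(X, ClosedModel (m + 1) cP.W) := OnePoint.collapseCM he.isOpen_range φ with hπ
  have hπe : ∀ y, π (e y) = ClosedModel.ofInterior y := by
    intro y
    have h1 := OnePoint.collapse_apply_of_mem (range e) φ (x := e y) ⟨y, rfl⟩
    rw [hφy] at h1
    exact h1
  have hπout : ∀ x, x ∉ range e → π x = ClosedModel.infty := fun x hx =>
    OnePoint.collapse_apply_of_not_mem _ _ hx
  have hmaps : ∀ y, MapsTo π ({e y}ᶜ : Set X) ({ClosedModel.ofInterior y}ᶜ : Set _) := by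
    intro y
    have h := OnePoint.mapsTo_collapse_compl_singleton φ.injective ⟨e y, ⟨y, rfl⟩⟩
    rw [hφy] at h
    exact h
  refine ⟨π, hπe, hπout, hmaps, fun α wP hloc => ?_⟩
  -- transfer of classes: compare local classes at every finite point
  obtain ⟨κ⟩ := BoundaryData.nonempty_collar_of_compactSpace m cP.W cP.boundaryData
  rw [← sub_eq_zero]
  apply cP.eq_zero_of_forall_toLocal_eq_zero_of_ne_infty κ ℤ ℤ
  intro x hx
  induction x using OnePoint.rec with
  | infty => exact absurd rfl hx
  | coe y =>
    obtain ⟨ζ, h₁, h₂⟩ := hloc y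
    rw [map_sub, sub_eq_zero]
    change singularHomology.toLocal ℤ ℤ (ClosedModel.ofInterior y) (m + 1 + 1) _ =
      singularHomology.toLocal ℤ ℤ (ClosedModel.ofInterior y) (m + 1 + 1) _
    rw [singularHomology.toLocal_map_apply' ℤ ℤ π (e y) (ClosedModel.ofInterior y) (hmaps y), h₁, h₂]
    have hcomp : π.comp e = ofInteriorCM cP := by
      ext y' : 1
      exact hπe y'
    have hc := relativeSingularHomology.map_comp ℤ ℤ e π
      (LocalFamily.mapsTo_compl_pt he.injective y) (hmaps y) (m + 1 + 1)
    have hc' := relativeSingularHomology.map_congr_fun' (R := ℤ) hcomp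
      ((hmaps y).comp (LocalFamily.mapsTo_compl_pt he.injective y))
      (LocalFamily.mapsTo_compl_pt (isOpenEmbedding_ofInteriorCM cP).injective y) (m + 1 + 1)
    exact ((ConcreteCategory.congr_hom hc ζ).symm.trans (ConcreteCategory.congr_hom hc' ζ))

end NullCobordism

end Literature.Topology.FourManifolds

end
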